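import Summits.QuantumFields.QCD.Theorems.SpectralDefectExtinctionWegnerEstimateBadPortJunkGeometry
import Summits.QuantumFields.QCD.Theorems.SpectralDefectExtinctionWegnerEstimateStubPortRigidity
import Summits.QuantumFields.QCD.Theorems.SpectralDefectExtinctionWegnerEstimateBadPortZeroSet

/-!
# Crux `WegnerEstimate` (item stmt-QuantumFields-8966), line `Sketch` gen 2c: the port min-functional VANISHES IDENTICALLY

Negative result of the continuation lead c3 (prover-line-stmt-QuantumFields-8966-c3-0): `badPort R w = 0` for every
radius `R` and every link datum `w`, hence the registered stub `stub_portSmallBall` (saturated Haar small ball for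
`badPort R`, the last open stub of the gen-2c skeleton) is FALSE — its sublevel sets are the whole configuration space.

Mechanism (COLLECTIVE 2-edge junk).  The port domain keeps the 2-edges of the cube (sites with exactly two extreme
coordinates) as unknowns but — correctly — imposes no equation there (both unknown outward neighbours would have to
be projected away, and `ran(Γ₅P_∓^μ) ⊕ ran(Γ₅P_∓^ν) = ℂ⁴`).  A SINGLE 2-edge value is killed by the port equations of
its two inward faces (12 equations, 12 unknowns; Lines/Sketch.md §gen 2c), but TWO 2-edge sites sharing an inward
face are not: `z₁ = (R, R, R−1, R−1)` and `z₂ = (R, R−1, R, R−1)` are seen only by the faces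
`f₁ = (R, R−1, R−1, R−1)` (both, forward hops in directions `1` and `2`), `f₂ = (R−1, R, R−1, R−1)` (`z₁`, direction
`0`) and `f₃ = (R−1, R−1, R, R−1)` (`z₂`, direction `0`): 24 complex unknowns against 3 × 6 port equations.  Explicit
kernel: `φ(z₁) = c ⊗ s`, `φ(z₂) = −(W(f₁,2)⁻¹ W(f₁,1) c) ⊗ s` with `s = (1, 0, 0, i)` the `+1` eigenvector of `γ₀`
(`P_-^0 s = 0` kills the direction-`0` hops into `f₂`, `f₃` outright; at `f₁` the two hops add up to
`(W₁c) ⊗ Γ₅ (P_-^2 − P_-^1) s`, which `P_-^0` annihilates by anticommutation) and `c ∈ ℂ³` arbitrary.  The two sites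
are not joined by a link (no current), are not neighbours of `box (R−1)` (no interior residual), and are not faces;
so the field is a non-zero port-admissible currentless field for EVERY `w`, `m₀`, `λ`, and `badPort R w = 0`
(`badPort_eq_zero`, via the landed `badPort_eq_zero_iff`, p148177; `R = 0`: landed `portRigidity_badPort_zero`).
Consequence: `not_portSmallBall` — the negation of the registered `stub_portSmallBall`, for every `R`, `m`, `C_B`.

What survives (for the planners): the composition of line Sketch is untouched (`stub_currentRigidity` takes ANY
admissible `bad`); what dies is every COMPACT local min-functional normalised on its own domain — rigidity must be
normalised by INTERIOR mass (`box R'`, `R' ≤ R − 2`), a non-compact variational problem (Lines/Sketch.md §gen 3).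
-/

noncomputable section

namespace Summit.QuantumFields.QCD.Cruxes.WegnerEstimate.ResolventCell

open scoped Matrix BigOperators
open Literature.MathematicalPhysics.QuantumLattice Literature.MathematicalPhysics.QuantumFieldTheory
  Literature.Probability.LatticeModels
open Matrix Complex

/-! ### The junk field -/

/-- Off the two junk sites the colour amplitude vanishes. -/
theorem junkColour_of_not_isJunkSite {R : ℕ} (w : LinkData) (c : Fin 3 → ℂ) {y : Fin 4 → ℤ}
    (hy : ¬ IsJunkSite R y) : junkColour R w c y = 0 := by
  unfold junkColour IsJunkSite at *
  push Not at hy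
  rw [if_neg hy.1, if_neg hy.2]

/-- The zero-extended junk field IS the product field `junkColour ⊗ junkSpinor` on all of `ℤ⁴` (`R ≥ 1`: both
junk sites lie in the port domain). -/
theorem portVal_junkField {R : ℕ} (hR : 1 ≤ R) (w : LinkData) (c : Fin 3 → ℂ) :
    portVal (junkField R w c) = fun y b β => junkColour R w c y b * junkSpinor β := by
  funext y b β
  unfold portVal
  split_ifs with h
  · rfl
  · have hy : ¬ IsJunkSite R y := by
      rintro (rfl | rfl)
      · exact h (junkSite_mem_portDomain hR).1
      · exact h (junkSite_mem_portDomain hR).2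
    rw [junkColour_of_not_isJunkSite w c hy, Pi.zero_apply, zero_mul]

/-- Colour cancellation at the shared face: `W(f₁,1) c + W(f₁,2) (junk colour at z₂) = 0`. -/
theorem junkColour_cancel (R : ℕ) (w : LinkData) (c : Fin 3 → ℂ) :
    (((w (junkFace₁ R, 1) : SU3) : Matrix (Fin 3) (Fin 3) ℂ) *ᵥ junkColour R w c (junkSite₁ R)) +
      (((w (junkFace₁ R, 2) : SU3) : Matrix (Fin 3) (Fin 3) ℂ) *ᵥ junkColour R w c (junkSite₂ R)) = 0 := by
  have hne : junkSite₂ R ≠ junkSite₁ R := by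
    intro h; have h' := congrFun h 1; simp at h'
  have h1 : junkColour R w c (junkSite₁ R) = c := if_pos rfl
  have h2 : junkColour R w c (junkSite₂ R) =
      -((((w (junkFace₁ R, 2))⁻¹ * w (junkFace₁ R, 1) : SU3) : Matrix (Fin 3) (Fin 3) ℂ) *ᵥ c) := by
    unfold junkColour; rw [if_neg hne, if_pos rfl]
  rw [h1, h2, Matrix.mulVec_neg, Matrix.mulVec_mulVec, ← Submonoid.coe_mul, mul_inv_cancel_left, add_neg_cancel]

/-! ### The three terms of the port functional vanish on the junk field -/

/-- **All cube currents of the junk field vanish**: no link has both endpoints on the support. -/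
theorem portCurrentSum_junkField {R : ℕ} (hR : 1 ≤ R) (w : LinkData) (c : Fin 3 → ℂ) :
    portCurrentSum R w (junkField R w c) = 0 := by
  rw [portCurrentSum]
  refine Finset.sum_eq_zero fun y _ => Finset.sum_eq_zero fun μ _ => Finset.sum_eq_zero fun i _ => ?_
  rw [portVal_junkField hR, latticeCurrent_productField_eq_zero, abs_zero]
  by_cases hy : IsJunkSite R y
  · exact Or.inr (junkColour_of_not_isJunkSite w c (not_isJunkSite_add_single hy μ))
  · exact Or.inl (junkColour_of_not_isJunkSite w c hy)

/-- **The interior residual of the junk field vanishes**: no site of `box (R−1)` is, or neighbours, a junk site. -/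
theorem portInteriorResSq_junkField {R : ℕ} (hR : 1 ≤ R) (w : LinkData) (c : Fin 3 → ℂ) (m₀ lam : ℝ) :
    portInteriorResSq R m₀ lam w (junkField R w c) = 0 := by
  rw [portInteriorResSq]
  refine Finset.sum_eq_zero fun y hy => Finset.sum_eq_zero fun a _ => Finset.sum_eq_zero fun α _ => ?_
  rw [portVal_junkField hR, latticeApply_productField]
  have hg := fun μ => not_isJunkSite_of_mem_box hR hy μ
  have h0 : junkColour R w c y = 0 := junkColour_of_not_isJunkSite w c (hg 0).1
  have hp : ∀ μ, junkColour R w c (y + Pi.single μ 1) = 0 := fun μ =>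
    junkColour_of_not_isJunkSite w c (hg μ).2.1
  have hm : ∀ μ, junkColour R w c (y - Pi.single μ 1) = 0 := fun μ =>
    junkColour_of_not_isJunkSite w c (hg μ).2.2
  simp [h0, hp, hm]

/-- **The port-projected face residual of the junk field vanishes.**  Generic faces see nothing; `f₂`, `f₃` see one
junk site through a direction-`0` hop, killed by `fwdHop 0 · s = 0`; the shared face `f₁` sees both, and after the
colour cancellation the spin part is `P_-^0 Γ₅ (P_-^2 − P_-^1) s = 0`. -/
theorem portFaceResSq_junkField {R : ℕ} (hR : 1 ≤ R) (w : LinkData) (c : Fin 3 → ℂ) (m₀ lam : ℝ) :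
    portFaceResSq R m₀ lam w (junkField R w c) = 0 := by
  rw [portFaceResSq]
  refine Finset.sum_eq_zero fun y hy => Finset.sum_eq_zero fun a _ => Finset.sum_eq_zero fun α _ => ?_
  rw [portVal_junkField hR]
  obtain ⟨hy0, hback, hz1, hz2⟩ := face_junk_geometry hR hy
  obtain ⟨hf1, hf2, hf3, h12, h13, h23, e11, e12, e20, e30⟩ := junkFace_facts R
  have hcol0 : junkColour R w c y = 0 := junkColour_of_not_isJunkSite w c hy0
  have hcolm : ∀ μ, junkColour R w c (y - Pi.single μ 1) = 0 := fun μ =>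
    junkColour_of_not_isJunkSite w c (hback μ)
  -- forward amplitudes vanish except at the four incidences
  have hfwd : ∀ μ : Fin 4, ¬ (μ = 0 ∧ y = junkFace₂ R) → ¬ (μ = 1 ∧ y = junkFace₁ R) →
      ¬ (μ = 0 ∧ y = junkFace₃ R) → ¬ (μ = 2 ∧ y = junkFace₁ R) →
      junkColour R w c (y + Pi.single μ 1) = 0 := by
    intro μ n1 n2 n3 n4
    refine junkColour_of_not_isJunkSite w c ?_
    rintro (h | h)
    · rcases hz1 μ h with h' | h'
      · exact n1 h'
      · exact n2 h'
    · rcases hz2 μ h with h' | h'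
      · exact n3 h'
      · exact n4 h'
  simp only [latticeApply_productField, hcol0, hcolm, Matrix.mulVec_zero, Pi.zero_apply, zero_mul, mul_zero,
    add_zero, zero_add, sub_zero]
  by_cases h1 : y = junkFace₁ R
  · subst h1
    have c0 : junkColour R w c (junkFace₁ R + Pi.single 0 1) = 0 :=
      hfwd 0 (fun h => h12 h.2) (fun h => absurd h.1 (by decide)) (fun h => h13 h.2) (fun h => absurd h.1 (by decide))
    have c3 : junkColour R w c (junkFace₁ R + Pi.single 3 1) = 0 :=
      hfwd 3 (fun h => absurd h.1 (by decide)) (fun h => absurd h.1 (by decide)) (fun h => absurd h.1 (by decide))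
        (fun h => absurd h.1 (by decide))
    set K : Fin 3 → ℂ := (((w (junkFace₁ R, 1) : SU3) : Matrix (Fin 3) (Fin 3) ℂ) *ᵥ junkColour R w c (junkSite₁ R))
      with hK
    have hc : (((w (junkFace₁ R, 2) : SU3) : Matrix (Fin 3) (Fin 3) ℂ) *ᵥ junkColour R w c (junkSite₂ R)) = -K :=
      eq_neg_of_add_eq_zero_right (junkColour_cancel R w c)
    have inner : ∀ β : Fin 4, (∑ μ : Fin 4, ((((w (junkFace₁ R, μ) : SU3) : Matrix (Fin 3) (Fin 3) ℂ) *ᵥ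
        junkColour R w c (junkFace₁ R + Pi.single μ 1)) a * (fwdHop μ *ᵥ junkSpinor) β)) =
        K a * ((fwdHop 1 *ᵥ junkSpinor) β - (fwdHop 2 *ᵥ junkSpinor) β) := fun β => by
      rw [Fin.sum_univ_four, c0, c3, e11, e12, hc, ← hK]
      simp only [Matrix.mulVec_zero, Pi.zero_apply, zero_mul, zero_add, add_zero, Pi.neg_apply]
      ring
    simp only [inner]
    have hsum : (∑ β : Fin 4, portProj R (junkFace₁ R) α β *
        (K a * ((fwdHop 1 *ᵥ junkSpinor) β - (fwdHop 2 *ᵥ junkSpinor) β))) =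
        K a * ((portProj R (junkFace₁ R) * (fwdHop 1 - fwdHop 2)) *ᵥ junkSpinor) α := by
      rw [← Matrix.mulVec_mulVec, Matrix.sub_mulVec,
        show (portProj R (junkFace₁ R) *ᵥ (fwdHop 1 *ᵥ junkSpinor - fwdHop 2 *ᵥ junkSpinor)) α =
          ∑ β, portProj R (junkFace₁ R) α β * ((fwdHop 1 *ᵥ junkSpinor) β - (fwdHop 2 *ᵥ junkSpinor) β) from rfl,
        Finset.mul_sum]
      exact Finset.sum_congr rfl fun β _ => by ring
    rw [hsum, portRigidity_portProj_of_eq hR hy hf1, portProj_fwdHop_sub_mulVec_junkSpinor, Pi.zero_apply,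
      mul_zero, norm_zero, zero_pow two_ne_zero]
  by_cases h2 : y = junkFace₂ R
  · subst h2
    have cμ : ∀ μ : Fin 4, μ ≠ 0 → junkColour R w c (junkFace₂ R + Pi.single μ 1) = 0 := fun μ hμ =>
      hfwd μ (fun h => hμ h.1) (fun h => h12 h.2.symm) (fun h => hμ h.1) (fun h => h12 h.2.symm)
    simp [Fin.sum_univ_four, cμ 1 (by decide), cμ 2 (by decide), cμ 3 (by decide), e20, fwdHop_zero_mulVec_junkSpinor]
  by_cases h3 : y = junkFace₃ R
  · subst h3
    have cμ : ∀ μ : Fin 4, μ ≠ 0 → junkColour R w c (junkFace₃ R + Pi.single μ 1) = 0 := fun μ hμ =>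
      hfwd μ (fun h => hμ h.1) (fun h => h13 h.2.symm) (fun h => hμ h.1) (fun h => h13 h.2.symm)
    simp [Fin.sum_univ_four, cμ 1 (by decide), cμ 2 (by decide), cμ 3 (by decide), e30, fwdHop_zero_mulVec_junkSpinor]
  -- generic face
  have cμ : ∀ μ : Fin 4, junkColour R w c (y + Pi.single μ 1) = 0 := fun μ =>
    hfwd μ (fun h => h2 h.2) (fun h => h1 h.2) (fun h => h3 h.2) (fun h => h1 h.2)
  simp [cμ]

/-! ### Normalisation and the vanishing of the functional -/

/-- The junk field is homogeneous in the colour vector. -/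
theorem junkField_smul (R : ℕ) (w : LinkData) (t : ℂ) (c : Fin 3 → ℂ) :
    junkField R w (t • c) = t • junkField R w c := by
  funext p
  simp only [junkField, junkColour, Pi.smul_apply, smul_eq_mul]
  split_ifs <;> simp [Matrix.mulVec_smul, mul_assoc]

/-- Squared norm of a scaled field. -/
theorem portNormSq_smul (R : ℕ) (t : ℝ) (φ : PortField R) :
    portNormSq R ((t : ℂ) • φ) = t ^ 2 * portNormSq R φ := by
  simp only [portNormSq, Pi.smul_apply, smul_eq_mul, norm_mul, Complex.norm_real, Real.norm_eq_abs, mul_pow,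
    sq_abs, Finset.mul_sum]

/-- The junk field with colour vector `e₀` is not zero: its squared norm is positive (`R ≥ 1`). -/
theorem portNormSq_junkField_pos {R : ℕ} (hR : 1 ≤ R) (w : LinkData) :
    0 < portNormSq R (junkField R w (Pi.single 0 1)) := by
  rw [portNormSq]
  have hmem := (junkSite_mem_portDomain hR).1
  let p₀ : ↥(portDomain R) × Fin 3 × Fin 4 := (⟨junkSite₁ R, hmem⟩, 0, 0)
  have hp₀ : ‖junkField R w (Pi.single 0 1) p₀‖ ^ 2 = 1 := by
    simp [p₀, junkField, junkColour, junkSpinor]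
  calc (0 : ℝ) < 1 := one_pos
    _ = ‖junkField R w (Pi.single 0 1) p₀‖ ^ 2 := hp₀.symm
    _ ≤ ∑ p, ‖junkField R w (Pi.single 0 1) p‖ ^ 2 :=
        Finset.single_le_sum (f := fun p => ‖junkField R w (Pi.single 0 1) p‖ ^ 2) (fun _ _ => by positivity)
          (Finset.mem_univ p₀)

/-- **The port min-functional vanishes identically** (every radius, every link datum): the normalised junk field is
a unit port field with all cube currents zero and both residuals zero (at `m₀ = 0`, `λ = 0`, or any other values). -/
theorem badPort_eq_zero (R : ℕ) (w : LinkData) : badPort R w = 0 := by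
  rcases Nat.eq_zero_or_pos R with rfl | hR
  · exact portRigidity_badPort_zero w
  · rw [badPort_eq_zero_iff hR]
    set N := portNormSq R (junkField R w (Pi.single 0 1)) with hN
    have hNpos : 0 < N := portNormSq_junkField_pos hR w
    set t : ℝ := (Real.sqrt N)⁻¹ with ht
    have htN : t ^ 2 * N = 1 := by
      rw [ht, inv_pow, Real.sq_sqrt hNpos.le, inv_mul_cancel₀ hNpos.ne']
    refine ⟨0, 0, junkField R w ((t : ℂ) • Pi.single 0 1), by norm_num, le_rfl, by norm_num, ?_,
      portCurrentSum_junkField hR w _, portInteriorResSq_junkField hR w _ 0 0, portFaceResSq_junkField hR w _ 0 0⟩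
    rw [junkField_smul, portNormSq_smul, ← hN, htN]

/-- **The registered stub `stub_portSmallBall` is FALSE**: since `badPort R ≡ 0`, for every radius `R`, exponent
`m > 1` and constant `C_B`, the saturated sublevel set `{V | ∃ g, badPort R (…) < δ}` is the whole configuration
space, of product-Haar measure `1 > C_B δ^m` for small `δ`.  (Witness: `L = 2`, `x = 0`, `U ≡ 1`, `e₀ = (0, 0)`,
`δ = min ½ (2 C_B)⁻¹`.) -/
theorem not_portSmallBall : ¬ ∃ (R : ℕ) (m C_B : ℝ), 1 < m ∧ 0 < C_B ∧
    ∀ (L : ℕ) [NeZero L], 2 ≤ L → ∀ (x : TorusSite 4 L) (U : GaugeConfig 4 L SU3) (e₀ : Edge 4 L) (δ : ℝ),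
      0 < δ → δ ≤ 1 →
      (MeasureTheory.Measure.pi fun _ : Edge 4 L => haarProbability SU3)
          {V : GaugeConfig 4 L SU3 | ∃ g : SU3,
            badPort R (fun l => (fun e : Edge 4 L => if (∃ y ∈ box 4 R, e.1 = x + Torus.proj L y) then
                Function.update V e₀ g e else U e) (x + Torus.proj L l.1, l.2)) < δ} ≤
        ENNReal.ofReal (C_B * δ ^ m) := by
  rintro ⟨R, m, C_B, hm, hC, h⟩
  set δ : ℝ := min (1 / 2) (2 * C_B)⁻¹ with hδ
  have hδpos : 0 < δ := lt_min (by norm_num) (by positivity)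
  have hδhalf : δ ≤ 1 / 2 := min_le_left _ _
  have hδone : δ ≤ 1 := hδhalf.trans (by norm_num)
  have hδC : δ ≤ (2 * C_B)⁻¹ := min_le_right _ _
  haveI : MeasureTheory.IsProbabilityMeasure (haarProbability SU3) :=
    ⟨by simpa [haarProbability] using MeasureTheory.Measure.haarMeasure_self (G := SU3) (K₀ := ⊤)⟩
  have key := h 2 le_rfl 0 (fun _ => 1) ((0 : TorusSite 4 2), (0 : Fin 4)) δ hδpos hδone
  have k2 : (MeasureTheory.Measure.pi fun _ : Edge 4 2 => haarProbability SU3) Set.univ ≤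
      ENNReal.ofReal (C_B * δ ^ m) := by
    refine le_trans (MeasureTheory.measure_mono fun V _ => ?_) key
    simp only [Set.mem_setOf_eq]
    exact ⟨1, by rw [badPort_eq_zero]; exact hδpos⟩
  rw [MeasureTheory.measure_univ] at k2
  have hle : (1 : ℝ) ≤ C_B * δ ^ m := ENNReal.one_le_ofReal.mp k2
  -- but `C_B δ^m ≤ C_B δ ≤ ½`
  have hδm : δ ^ m ≤ δ := by
    calc δ ^ m ≤ δ ^ (1 : ℝ) := Real.rpow_le_rpow_of_exponent_ge hδpos hδone hm.le
      _ = δ := Real.rpow_one δ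
  have : C_B * δ ^ m ≤ 1 / 2 := by
    calc C_B * δ ^ m ≤ C_B * δ := mul_le_mul_of_nonneg_left hδm hC.le
      _ ≤ C_B * (2 * C_B)⁻¹ := mul_le_mul_of_nonneg_left hδC hC.le
      _ = 1 / 2 := by rw [_root_.mul_inv_rev, ← mul_assoc, mul_inv_cancel₀ hC.ne', one_mul, one_div]
  linarith


end Summit.QuantumFields.QCD.Cruxes.WegnerEstimate.ResolventCell

end
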